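import Mathlib
import HarnessLib
import Summits.CriticalPhenomena.PercolationContinuityZ3.Theses.PercBudgetLadder
import Literature.Probability.Percolation.MinOpenCut
import Literature.Probability.Percolation.InequalitiesProofs
import Literature.Probability.Percolation.BondPercolationSymmetry

/-!
# Crux PinholeClosing (stmt-CriticalPhenomena-5249) — ideator 2, round 1: first-lemma signatures

Card `transit-doubling`.  Everything is stated over existing declarations
(`bondPercolation`, `zdGraph 3`, `criticalProbI 3`, `box`, `innerBoundary`, `openConnIn`);
the deterministic lemma `TransitLemma` and the probabilistic rung `PinholeClosingZeroWide`
are `def … : Prop` (to be proved by the line), the glue theorems at the end are proved here.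
-/

namespace Summit.CriticalPhenomena.PercolationContinuityZ3.Cruxes.PinholeClosing.TransitDoubling

open Literature.Probability.Percolation Literature.Probability.LatticeModels

noncomputable section

/-- The critical bond measure on `ℤ³`. -/
abbrev Pc : MeasureTheory.Measure (BondConfig (Site 3)) :=
  bondPercolation (zdGraph 3) (criticalProbI 3)

/-- The crossing event of the CENTRED annulus `B(m) → ∂ⁱⁿB(R)` inside `B(R)` for the
configuration `ω` (verbatim the route's inlined form). -/
def Cross (m R : ℕ) (ω : BondConfig (Site 3)) : Prop :=
  ∃ a ∈ box 3 m, ∃ b ∈ innerBoundary (zdGraph 3) (box 3 R), ω ∈ openConnIn ↑(box 3 R) a b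

/-- Budget-`j` blocking of the centred annulus: closing at most `j` edges destroys every crossing
(`= {minOpenCutIn ≤ j}` by `minOpenCutIn_le_iff`). -/
def Budget (m R j : ℕ) : Set (BondConfig (Site 3)) :=
  {ω | ∃ S : Finset (Sym2 (Site 3)), S.card ≤ j ∧ ¬ Cross m R (ω \ ↑S)}

/-- Budget-`j` blocking of the TRANSLATED annulus `x + (B(m) → ∂ⁱⁿB(R))`, written as the
shift-preimage of the centred event (so that `bondPercolation_real_preimage_shift` gives it the
same probability as the centred one). -/
def BudgetAt (x : Site 3) (m R j : ℕ) : Set (BondConfig (Site 3)) :=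
  BondConfig.relabel (sym2Equiv (Site.shift x)) ⁻¹' Budget m R j

/-- **Transit doubling (deterministic first lemma).**  A simple open path that visits the inner
box `x + B(n)` of a translated annulus `x + A(n, ln)` while starting and ending outside the
interior `x + B(ln - 1)` contains TWO edge-disjoint crossings of that annulus (its entry segment
reversed, and its exit segment), so it is incompatible with budget `≤ 1` there.  Every path from
`B(n)` to `∂ⁱⁿB(L)` inside `B(L)` crosses the sphere `∂ⁱⁿB(R)`; if `l n + n ≤ R` its start lies
outside (or on the boundary of) `z + B(ln)` for every `z` on that sphere, and if `R + l n ≤ L`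
its end does too.  Hence: budget `≤ 1` at every sphere point forces the wide annulus
`B(n) → ∂ⁱⁿB(L)` to be blocked outright (budget `0`).  (`BudgetAt z` is the budget event of the annulus
centred at `±z` according to the sign convention of `Site.shift`; the sphere is symmetric, so the
statement does not depend on the convention.) -/
def TransitLemma : Prop :=
  ∀ (n l R L : ℕ), 1 ≤ n → 1 ≤ l → l * n + n ≤ R → R + l * n ≤ L →
    ∀ ω : BondConfig (Site 3),
      (∀ z ∈ innerBoundary (zdGraph 3) (box 3 R), ω ∈ BudgetAt z n (l * n) 1) → ¬ Cross n L ω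

/-- **k = 0 rung, wide form (probabilistic first lemma).**  Budget `≤ 1` at aspect `l` with
probability `≥ c` forces outright blocking at outer radius `(2l+1)n` with probability `≥ c'`,
uniformly in `n`: `c' = c^{|X|}` where `X` is a `(2n+1)`-spaced grid of the sphere of radius
`ln + n` (`|X| ≤ 6(l+2)²`, independent of `n`), by `TransitLemma`,
translation invariance (`bondPercolation_real_preimage_shift`) and Harris–FKG for the decreasing
local events `BudgetAt z n (ln) 1` (`harris_fkg_lower`). -/
def PinholeClosingZeroWide : Prop :=
  ∀ (l : ℕ) (c : ℝ), 2 ≤ l → 0 < c → ∃ c' : ℝ, 0 < c' ∧ ∀ n : ℕ, 1 ≤ n →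
    c ≤ Pc.real (Budget n (l * n) 1) → c' ≤ Pc.real {ω | ¬ Cross n ((2 * l + 1) * n) ω}

/-- The recommended RESTATEMENT of the crux (aspect `l ↦ 3l` instead of `l ↦ 2l`; the route's
descent is insensitive to the growth factor): for the tenure planner, not a claim of this card
beyond `k = 0`. -/
def PinholeClosingTriple : Prop :=
  ∀ (k l : ℕ) (c : ℝ), 2 ≤ l → 0 < c → ∃ c' : ℝ, 0 < c' ∧ ∀ n : ℕ, 1 ≤ n →
    c ≤ Pc.real (Budget n (l * n) (k + 1)) → c' ≤ Pc.real (Budget n (3 * l * n) k)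

/-- Budget-one tightness along a subsequence (the `K = 1` case of the route's
`BudgetTightness`). -/
def BudgetOneTightness : Prop :=
  ∃ (l : ℕ) (c : ℝ), 2 ≤ l ∧ 0 < c ∧ ∀ N : ℕ, ∃ n : ℕ, N ≤ n ∧ c ≤ Pc.real (Budget n (l * n) 1)

/-- **Recommended flexible restatement of the crux** (card `budget-halving`): trade inner radius
for budget — hypothesis at inner radius `n`, aspect `l`, budget `k+1`; conclusion at inner radius
`⌈n/2⌉ = (n+1)/2`, SOME `n`-independent aspect `l'`, budget `k`.  The route's descent survives
(inner radii `⌈n/2^K⌉ → ∞` along the subsequence), see `critAnnulusBlockedIO_of_flex`. -/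
def PinholeClosingFlex : Prop :=
  ∀ (k l : ℕ) (c : ℝ), 2 ≤ l → 0 < c → ∃ (l' : ℕ) (c' : ℝ), 2 ≤ l' ∧ 0 < c' ∧ ∀ n : ℕ, 1 ≤ n →
    c ≤ Pc.real (Budget n (l * n) (k + 1)) →
      c' ≤ Pc.real (Budget ((n + 1) / 2) (l' * ((n + 1) / 2)) k)

/-- **Flat-landscape exclusion, budget `K`** (card `budget-halving`, the deterministic heart;
`K = 1` is `TransitLemma`, `K = 2` is sketched on the card, `K ≥ 3` conjectural): for `l ≥ 16`
(w.l.o.g.: the squeeze may raise the hypothesis aspect) there is NO configuration in which every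
`n`-window of the `⌊n/4⌋`-grid of `B(3ln)` has budget `≤ K` at range `ln` ("caps") while every
`⌈n/2⌉`-box of the same grid has budget `≥ K`, i.e. NOT `≤ K-1`, at range `4ln` ("floors").  With Harris–FKG on the caps (decreasing, `O(l³)` of them) and a union
bound on the floors (each fails with the conclusion probability, by translation invariance) it
yields `PinholeClosingFlex` at level `k + 1 = K` with `l' = 8l`, `c' = c^{O(l³)}/O(l³)`. -/
def FlatLandscapeExclusion (K : ℕ) : Prop :=
  ∀ (n l : ℕ), 4 ≤ n → 16 ≤ l → ∀ ω : BondConfig (Site 3),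
    (∀ x : Site 3, (∀ i, (x i).natAbs ≤ 3 * l * n ∧ ((n / 4 : ℕ) : ℤ) ∣ x i) →
        ω ∈ BudgetAt x n (l * n) K) →
    ∃ y : Site 3, (∀ i, (y i).natAbs ≤ 3 * l * n ∧ ((n / 4 : ℕ) : ℤ) ∣ y i) ∧
        ω ∈ BudgetAt y ((n + 1) / 2) (4 * l * n) (K - 1)

/-! ### Glue (proved): the wide `k = 0` rung turns budget-one tightness into the route target -/

/-- `Budget n R 0` is literally the blocked event. -/
theorem budget_zero_iff (n R : ℕ) (ω : BondConfig (Site 3)) :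
    ω ∈ Budget n R 0 ↔ ¬ Cross n R ω := by
  constructor
  · rintro ⟨S, hS, h⟩
    have hS0 : S = ∅ := Finset.card_eq_zero.mp (Nat.le_zero.mp hS)
    subst hS0
    simpa using h
  · intro h
    exact ⟨∅, by simp, by simpa using h⟩

/-- The route's target `CritAnnulusBlockedIO` follows from `PinholeClosingZeroWide` and
`BudgetOneTightness` (aspect `2l+1`).  Pure logic. -/
theorem critAnnulusBlockedIO_of (h0 : PinholeClosingZeroWide) (h1 : BudgetOneTightness) :
    Theses.PercBudgetLadder.CritAnnulusBlockedIO := by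
  obtain ⟨l, c, hl, hc, hio⟩ := h1
  obtain ⟨c', hc', hstep⟩ := h0 l c hl hc
  refine ⟨2 * l + 1, c', by omega, hc', ?_⟩
  intro N
  obtain ⟨n, hn, hbound⟩ := hio (N + 1)
  refine ⟨n, by omega, ?_⟩
  have := hstep n (by omega) hbound
  simpa [Cross] using this

/-- The `k = 0` instance of the restated crux `PinholeClosingTriple` follows from the wide rung
(blocking at radius `(2l+1)n ≤ 3ln` is blocking at radius `3ln` … no: a THINNER blocked annulus
implies the thicker one is blocked, and `(2l+1) n ≤ 3 l n`, so `¬ Cross n ((2l+1)n) → ¬ Cross n (3ln)`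
needs the monotonicity of `Cross` in the outer radius, recorded here as the hypothesis `hmono`). -/
theorem pinholeClosingTriple_zero_of (h0 : PinholeClosingZeroWide)
    (hmono : ∀ (n R R' : ℕ) (ω : BondConfig (Site 3)), R ≤ R' → Cross n R' ω → Cross n R ω) :
    ∀ (l : ℕ) (c : ℝ), 2 ≤ l → 0 < c → ∃ c' : ℝ, 0 < c' ∧ ∀ n : ℕ, 1 ≤ n →
      c ≤ Pc.real (Budget n (l * n) 1) → c' ≤ Pc.real (Budget n (3 * l * n) 0) := by
  intro l c hl hc
  obtain ⟨c', hc', hstep⟩ := h0 l c hl hc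
  refine ⟨c', hc', fun n hn hb => ?_⟩
  have h1 := hstep n hn hb
  have hsub : {ω : BondConfig (Site 3) | ¬ Cross n ((2 * l + 1) * n) ω} ⊆ Budget n (3 * l * n) 0 := by
    intro ω hω
    rw [budget_zero_iff]
    intro hx
    exact hω (hmono n ((2 * l + 1) * n) (3 * l * n) ω (by nlinarith) hx)
  exact h1.trans (MeasureTheory.measureReal_mono hsub)

/-- The route target from the route's OWN `BudgetTightness` and the flexible restatement
`PinholeClosingFlex` (inner radius halves at each of the `K` descent steps; pure logic). -/
theorem critAnnulusBlockedIO_of_flex (hT : Theses.PercBudgetLadder.BudgetTightness)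
    (hF : PinholeClosingFlex) : Theses.PercBudgetLadder.CritAnnulusBlockedIO := by
  -- i.o. form at budget K
  have descent : ∀ K : ℕ, ∀ (l : ℕ) (c : ℝ), 2 ≤ l → 0 < c →
      (∀ N : ℕ, ∃ m : ℕ, N ≤ m ∧ c ≤ Pc.real (Budget m (l * m) K)) →
      ∃ (l' : ℕ) (c' : ℝ), 2 ≤ l' ∧ 0 < c' ∧
        ∀ N : ℕ, ∃ m : ℕ, N ≤ m ∧ c' ≤ Pc.real (Budget m (l' * m) 0) := by
    intro K
    induction K with
    | zero => exact fun l c hl hc h => ⟨l, c, hl, hc, h⟩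
    | succ K ih =>
      intro l c hl hc h
      obtain ⟨l', c', hl', hc', hstep⟩ := hF K l c hl hc
      refine ih l' c' hl' hc' ?_
      intro N
      obtain ⟨m, hm, hbound⟩ := h (2 * N + 1)
      refine ⟨(m + 1) / 2, by omega, hstep m (by omega) hbound⟩
  obtain ⟨K, l, c, hl, hc, hio⟩ := hT
  obtain ⟨l', c', hl', hc', hio'⟩ := descent K l c hl hc (fun N => by
    obtain ⟨n, hn, hb⟩ := hio N
    exact ⟨n, hn, by simpa [Budget, Cross] using hb⟩)
  refine ⟨l', c', hl', hc', fun N => ?_⟩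
  obtain ⟨m, hm, hb⟩ := hio' N
  refine ⟨m, hm, ?_⟩
  have hset : Budget m (l' * m) 0 = {ω | ¬ Cross m (l' * m) ω} := by
    ext ω; exact budget_zero_iff m (l' * m) ω
  rw [hset] at hb
  simpa [Cross] using hb

end

end Summit.CriticalPhenomena.PercolationContinuityZ3.Cruxes.PinholeClosing.TransitDoubling
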